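import Mathlib.Analysis.SpecificLimits.Basic
import Literature.Geometry.Lorentzian.KerrConvergence
import Summits.FinalStateConjecture.FinalStateConjecture.Theorems.EIHFluxBalanceModulatedKerrHandoffAnnulusRigidityMinkowskiNorm

/-!
# Route EIHFluxBalance — `ModulatedKerrHandoff`, stub `stub_annulusRigidity`: the nearest Lorentz transformation

Helper file for the crux `stmt-FinalStateConjecture-10167`
(`Summit.FinalStateConjecture.FinalStateConjecture.Theses.EIHFluxBalance.ModulatedKerrHandoff`),
line `overlap-modulation-second-iterate`, stub `stub_annulusRigidity` (rigidity of almost-isometric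
`C²` maps of a Minkowski annulus).

**Claim.** If an endomorphism `B` of `E4` has `‖B‖ ≤ Γ` and its pulled-back Minkowski form is
`ε`-close to `η`, `‖η(B·, B·) − η‖ ≤ ε ≤ 1/2` (Euclidean operator norms), then there is a Lorentz
transformation `L ∈ lorentzGroup` with `‖B − L‖ ≤ 2 Γ ε` (`exists_lorentz_norm_sub_le`).

**Proof (Newton–Schulz iteration for the `η`-polar factor, no square roots).** With the `η`-adjoint
`X ↦ θ X† θ` and the defect endomorphism `D(X) = θ X† θ X − 1` of
`…AnnulusRigidityMinkowskiNorm` (`η(D(X) v, w) = η(Xv, Xw) − η(v, w)`, `‖D(X)‖ ≤ ‖η(X·,X·) − η‖`,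
`D(X)` is `η`-self-adjoint), iterate `X₀ = B`, `X_{k+1} = X_k − ½ X_k D(X_k)`. The algebraic identity
`D(X_{k+1}) = −¾ D(X_k)² + ¼ D(X_k)³` (`defect_newton_step`) gives `‖D(X_k)‖ ≤ ε^(2^k)` and
`‖X_k‖ ≤ 2Γ(1 − ε^(2^k))`, so `‖X_{k+1} − X_k‖ ≤ Γ ε^(2^k) ≤ Γ ε · ε^k`; the sequence is Cauchy in
the complete space `E4 →L[ℝ] E4`, its limit `L` has `D(L) = 0`, i.e. `θ L† θ L = 1`, so `L` is an
`η`-isometry with a left inverse, hence (finite dimension) a continuous linear automorphism in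
`lorentzGroup`, and `‖B − L‖ ≤ Γε/(1 − ε) ≤ 2Γε`. Higham, *Functions of matrices* (2008), §8.3
(Newton–Schulz for the polar/orthogonal factor); O'Neill (1983), Ch. 9. [folklore]
-/

noncomputable section

-- `Summit.<S>.<S>.…` (single-problem summit, D-0017) trips core's duplicate-namespace linter.
set_option linter.dupNamespace false

open scoped InnerProductSpace Topology
open Filter Literature.Geometry.Lorentzian Literature.Geometry.Lorentzian.KerrSchild

namespace Summit.FinalStateConjecture.FinalStateConjecture.Theorems

namespace AnnulusRigidity

/-! ### One Newton step -/

/-- **The Newton–Schulz step squares the defect.** If `D = θ X† θ X − 1` is the defect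
endomorphism of `X` and `N = X − ½ X D`, then the defect of `N` is `−¾ D² + ¼ D³`. [folklore] -/
theorem defect_newton_step (X D N : E4 →L[ℝ] E4)
    (hD : D = (timeReflect : E4 →L[ℝ] E4) * star X * (timeReflect : E4 →L[ℝ] E4) * X - 1)
    (hN : N = X - (1 / 2 : ℝ) • (X * D)) :
    (timeReflect : E4 →L[ℝ] E4) * star N * (timeReflect : E4 →L[ℝ] E4) * N - 1 =
      -(3 / 4 : ℝ) • (D * D) + (1 / 4 : ℝ) • (D * D * D) := by
  -- the `η`-adjoint `A` of `X` and of `N`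
  set A : E4 →L[ℝ] E4 := (timeReflect : E4 →L[ℝ] E4) * star X * (timeReflect : E4 →L[ℝ] E4)
    with hA
  have hDA : (timeReflect : E4 →L[ℝ] E4) * star D * (timeReflect : E4 →L[ℝ] E4) = D := by
    rw [hD]; exact etaAdjoint_defect X
  have hP : A * X = 1 + D := by rw [hD, hA]; abel
  have hJN : (timeReflect : E4 →L[ℝ] E4) * star N * (timeReflect : E4 →L[ℝ] E4) =
      A - (1 / 2 : ℝ) • (D * A) := by
    rw [hN, etaAdjoint_sub, etaAdjoint_smul, etaAdjoint_mul, hDA]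
  have h1 : D * A * X = D * (1 + D) := by rw [mul_assoc, hP]
  have h2 : A * (X * D) = (1 + D) * D := by rw [← mul_assoc, hP]
  have h3 : D * A * (X * D) = D * (1 + D) * D := by
    rw [mul_assoc D A, ← mul_assoc A, hP, ← mul_assoc]
  rw [hJN, hN]
  simp only [mul_sub, sub_mul, smul_mul_assoc', mul_smul_comm']
  rw [h1, h2, h3, hP]
  simp only [mul_add, add_mul, one_mul, mul_one, smul_add, mul_assoc]
  module

/-- Norm of the new defect: `‖−¾ D² + ¼ D³‖ ≤ d²` when `‖D‖ ≤ d ≤ 1`. [folklore] -/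
theorem norm_defect_newton_le {D : E4 →L[ℝ] E4} {d : ℝ} (hD : ‖D‖ ≤ d) (hd : d ≤ 1) :
    ‖-(3 / 4 : ℝ) • (D * D) + (1 / 4 : ℝ) • (D * D * D)‖ ≤ d ^ 2 := by
  have hd0 : 0 ≤ d := (norm_nonneg D).trans hD
  have hDD : ‖D * D‖ ≤ d ^ 2 := by
    calc ‖D * D‖ ≤ ‖D‖ * ‖D‖ := norm_mul_le _ _
      _ ≤ d * d := mul_le_mul hD hD (norm_nonneg _) hd0
      _ = d ^ 2 := (sq d).symm
  have hDDD : ‖D * D * D‖ ≤ d ^ 2 * d := by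
    calc ‖D * D * D‖ ≤ ‖D * D‖ * ‖D‖ := norm_mul_le _ _
      _ ≤ d ^ 2 * d := mul_le_mul hDD hD (norm_nonneg _) (sq_nonneg _)
  calc ‖-(3 / 4 : ℝ) • (D * D) + (1 / 4 : ℝ) • (D * D * D)‖
      ≤ ‖-(3 / 4 : ℝ) • (D * D)‖ + ‖(1 / 4 : ℝ) • (D * D * D)‖ := norm_add_le _ _
    _ = 3 / 4 * ‖D * D‖ + 1 / 4 * ‖D * D * D‖ := by
        rw [norm_smul, norm_smul, norm_neg, Real.norm_of_nonneg (by norm_num : (0 : ℝ) ≤ 3 / 4),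
          Real.norm_of_nonneg (by norm_num : (0 : ℝ) ≤ 1 / 4)]
    _ ≤ 3 / 4 * d ^ 2 + 1 / 4 * (d ^ 2 * d) := by gcongr
    _ ≤ d ^ 2 := by nlinarith [sq_nonneg d]

/-! ### The iteration and its limit -/

/-- **Nearest Lorentz transformation.** If `‖B‖ ≤ Γ` and `‖η(B·, B·) − η‖ ≤ ε ≤ 1/2` (Euclidean
operator norms on `E4`) then some `L ∈ O(1,3)` has `‖B − L‖ ≤ 2Γε`. [folklore] -/
theorem exists_lorentz_norm_sub_le {B : E4 →L[ℝ] E4} {Γ ε : ℝ} (hB : ‖B‖ ≤ Γ)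
    (hd : ‖Minkowski.bilin.bilinearComp B B - Minkowski.bilin‖ ≤ ε) (hε : ε ≤ 1 / 2) :
    ∃ L : lorentzGroup, ‖B - ((L : E4 ≃L[ℝ] E4) : E4 →L[ℝ] E4)‖ ≤ 2 * Γ * ε := by
  have hε0 : 0 ≤ ε := (norm_nonneg (Minkowski.bilin.bilinearComp B B - Minkowski.bilin)).trans hd
  have hε1 : ε < 1 := by linarith
  have hΓ0 : 0 ≤ Γ := (norm_nonneg B).trans hB
  -- the defect map, the Newton map and the Newton sequence
  set Df : (E4 →L[ℝ] E4) → (E4 →L[ℝ] E4) := fun X ↦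
    (timeReflect : E4 →L[ℝ] E4) * star X * (timeReflect : E4 →L[ℝ] E4) * X - 1 with hDf
  set F : (E4 →L[ℝ] E4) → (E4 →L[ℝ] E4) := fun X ↦ X - (1 / 2 : ℝ) • (X * Df X) with hF
  set Xs : ℕ → (E4 →L[ℝ] E4) := fun k ↦ F^[k] B with hXs
  have hX0 : Xs 0 = B := rfl
  have hXsucc : ∀ k, Xs (k + 1) = F (Xs k) := fun k ↦ Function.iterate_succ_apply' F k B
  -- the quadratic invariant
  have hinv : ∀ k, ‖Df (Xs k)‖ ≤ ε ^ (2 ^ k) ∧ ‖Xs k‖ ≤ 2 * Γ * (1 - ε ^ (2 ^ k)) := by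
    intro k
    induction k with
    | zero =>
      refine ⟨?_, ?_⟩
      · rw [pow_zero, pow_one, hX0]; exact (norm_defect_le B).trans hd
      · rw [pow_zero, pow_one, hX0]; nlinarith
    | succ k ih =>
      obtain ⟨ihD, ihX⟩ := ih
      have hδ0 : 0 ≤ ε ^ (2 ^ k) := pow_nonneg hε0 _
      have hδ1 : ε ^ (2 ^ k) ≤ 1 := pow_le_one₀ hε0 hε1.le
      have hsq : ε ^ (2 ^ (k + 1)) = (ε ^ (2 ^ k)) ^ 2 := by rw [pow_succ, pow_mul]
      have hstep := defect_newton_step (Xs k) (Df (Xs k)) (Xs (k + 1)) rfl (hXsucc k)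
      refine ⟨?_, ?_⟩
      · rw [show Df (Xs (k + 1)) = _ from hstep, hsq]
        exact norm_defect_newton_le ihD hδ1
      · rw [hXsucc k]
        have hΓδ : 0 ≤ 2 * Γ * (1 - ε ^ (2 ^ k)) :=
          mul_nonneg (mul_nonneg two_pos.le hΓ0) (sub_nonneg.2 hδ1)
        have hkey : 0 ≤ Γ * (ε ^ (2 ^ k) * (1 - ε ^ (2 ^ k))) :=
          mul_nonneg hΓ0 (mul_nonneg hδ0 (sub_nonneg.2 hδ1))
        calc ‖F (Xs k)‖ ≤ ‖Xs k‖ + ‖(1 / 2 : ℝ) • (Xs k * Df (Xs k))‖ := norm_sub_le _ _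
          _ ≤ ‖Xs k‖ + 1 / 2 * (‖Xs k‖ * ‖Df (Xs k)‖) := by
              rw [norm_smul, Real.norm_of_nonneg (by norm_num : (0 : ℝ) ≤ 1 / 2)]
              exact add_le_add le_rfl (mul_le_mul_of_nonneg_left (norm_mul_le (Xs k) (Df (Xs k)))
                (by norm_num : (0 : ℝ) ≤ 1 / 2))
          _ ≤ 2 * Γ * (1 - ε ^ (2 ^ k)) + 1 / 2 * (2 * Γ * (1 - ε ^ (2 ^ k)) * ε ^ (2 ^ k)) :=
              add_le_add ihX (mul_le_mul_of_nonneg_left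
                (mul_le_mul ihX ihD (norm_nonneg _) hΓδ) (by norm_num : (0 : ℝ) ≤ 1 / 2))
          _ ≤ 2 * Γ * (1 - ε ^ (2 ^ (k + 1))) := by rw [hsq]; nlinarith [hkey]
  -- consecutive differences are geometrically small
  have hdiff : ∀ k, dist (Xs k) (Xs (k + 1)) ≤ Γ * ε * ε ^ k := by
    intro k
    obtain ⟨hD, hX⟩ := hinv k
    have hδ0 : 0 ≤ ε ^ (2 ^ k) := pow_nonneg hε0 _
    have hδ1 : ε ^ (2 ^ k) ≤ 1 := pow_le_one₀ hε0 hε1.le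
    have hΓδ : 0 ≤ 2 * Γ * (1 - ε ^ (2 ^ k)) :=
      mul_nonneg (mul_nonneg two_pos.le hΓ0) (sub_nonneg.2 hδ1)
    have hkey : 0 ≤ Γ * (ε ^ (2 ^ k) * ε ^ (2 ^ k)) := mul_nonneg hΓ0 (mul_nonneg hδ0 hδ0)
    have hδk : ε ^ (2 ^ k) ≤ ε ^ (k + 1) :=
      pow_le_pow_of_le_one hε0 hε1.le (Nat.lt_two_pow_self (n := k))
    rw [hXsucc k, dist_eq_norm, show Xs k - F (Xs k) = (1 / 2 : ℝ) • (Xs k * Df (Xs k)) by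
      simp only [hF]; abel, norm_smul, Real.norm_of_nonneg (by norm_num : (0 : ℝ) ≤ 1 / 2)]
    calc 1 / 2 * ‖Xs k * Df (Xs k)‖ ≤ 1 / 2 * (‖Xs k‖ * ‖Df (Xs k)‖) :=
          mul_le_mul_of_nonneg_left (norm_mul_le (Xs k) (Df (Xs k))) (by norm_num : (0 : ℝ) ≤ 1 / 2)
      _ ≤ 1 / 2 * (2 * Γ * (1 - ε ^ (2 ^ k)) * ε ^ (2 ^ k)) :=
          mul_le_mul_of_nonneg_left (mul_le_mul hX hD (norm_nonneg _) hΓδ)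
            (by norm_num : (0 : ℝ) ≤ 1 / 2)
      _ ≤ Γ * ε ^ (2 ^ k) := by nlinarith [hkey]
      _ ≤ Γ * ε ^ (k + 1) := mul_le_mul_of_nonneg_left hδk hΓ0
      _ = Γ * ε * ε ^ k := by ring
  have hcauchy : CauchySeq Xs := cauchySeq_of_le_geometric ε (Γ * ε) hε1 hdiff
  obtain ⟨L, hL⟩ := cauchySeq_tendsto_of_complete hcauchy
  have hdist : ‖B - L‖ ≤ 2 * Γ * ε := by
    have h := dist_le_of_le_geometric_of_tendsto₀ ε (Γ * ε) hε1 hdiff hL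
    rw [hX0, dist_eq_norm] at h
    refine h.trans ?_
    rw [div_le_iff₀ (by linarith)]
    nlinarith [mul_nonneg (mul_nonneg hΓ0 hε0) (by linarith : (0 : ℝ) ≤ 1 - 2 * ε)]
  -- the limit is an exact `η`-isometry
  have hcont : Continuous Df :=
    (((continuous_const.mul
      (ContinuousLinearMap.adjoint : (E4 →L[ℝ] E4) ≃ₗᵢ⋆[ℝ] (E4 →L[ℝ] E4)).continuous).mul
      continuous_const).mul continuous_id).sub continuous_const
  have hDL : Df L = 0 := by
    refine tendsto_nhds_unique ((hcont.tendsto L).comp hL) ?_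
    refine squeeze_zero_norm (fun k ↦ ?_) (tendsto_pow_atTop_nhds_zero_of_lt_one hε0 hε1)
    exact (hinv k).1.trans (pow_le_pow_of_le_one hε0 hε1.le (Nat.lt_two_pow_self (n := k)).le)
  have hJL : (timeReflect : E4 →L[ℝ] E4) * star L * (timeReflect : E4 →L[ℝ] E4) * L = 1 :=
    sub_eq_zero.1 hDL
  have hleft : ∀ v, ((timeReflect : E4 →L[ℝ] E4) * star L * (timeReflect : E4 →L[ℝ] E4)) (L v) =
      v := fun v ↦ by
    rw [← mul_apply_eq_comp, hJL, one_apply_eq_self]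
  have hsurj : Function.Surjective (L : E4 →ₗ[ℝ] E4) :=
    LinearMap.injective_iff_surjective.1 (Function.LeftInverse.injective hleft)
  have hright : ∀ v, L (((timeReflect : E4 →L[ℝ] E4) * star L *
      (timeReflect : E4 →L[ℝ] E4)) v) = v := fun v ↦ by
    obtain ⟨u, rfl⟩ := hsurj v
    exact congrArg L (hleft u)
  have hiso : ∀ v w, Minkowski.bilin (L v) (L w) = Minkowski.bilin v w := fun v w ↦ by
    rw [← bilin_etaAdjoint_mul_self_apply, hJL, one_apply_eq_self]
  exact ⟨⟨ContinuousLinearEquiv.equivOfInverse L _ hleft hright,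
    mem_lorentzGroup_iff.2 hiso⟩, hdist⟩

end AnnulusRigidity

/-- Registered sub-goal form (stub `annulusRigidity_exists_lorentz_norm_sub_le` of the crux item, helper for `stub_annulusRigidity`) of
`AnnulusRigidity.exists_lorentz_norm_sub_le`: the nearest Lorentz transformation (`‖B − L‖ ≤ 2Γε`). [folklore] -/
theorem annulusRigidity_exists_lorentz_norm_sub_le : open Literature.Geometry.Lorentzian in ∀ {B : E4 →L[ℝ] E4} {Γ ε : ℝ}, ‖B‖ ≤ Γ → ‖Minkowski.bilin.bilinearComp B B - Minkowski.bilin‖ ≤ ε → ε ≤ 1 / 2 → ∃ L : lorentzGroup, ‖B - ((L : E4 ≃L[ℝ] E4) : E4 →L[ℝ] E4)‖ ≤ 2 * Γ * ε :=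
  fun hB hd hε ↦ AnnulusRigidity.exists_lorentz_norm_sub_le hB hd hε

end Summit.FinalStateConjecture.FinalStateConjecture.Theorems

end
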